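import Mathlib
import Summits.NavierStokesRegularity.NavierStokesRegularity.Theorems.ThreadingFluxHorizonTowerFiniteTowerIsolation
import Summits.NavierStokesRegularity.NavierStokesRegularity.Theorems.ThreadingFluxHorizonTowerQuadraticGenerator
import HarnessLib

/-!
# Crux `PoloidalLiouville` (stmt-NavierStokesRegularity-1222), crux idea «horizon-threading-tower» (ns-idea-15):
# FINITE TOWERS AT ORDER ONE — THE CLASS POLYNOMIAL IDENTITY (all digits, not only the null-cone trace)

Support file (`--supports stmt-NavierStokesRegularity-1222`, helper; cell `ns-wall-extremal`, width hand ns-wall-eng-3 g5; 0 kit), toward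
THM E «the finite tower `{2, 4, 6}` is coaxially zonal at order one».

The isolation lemma `finiteTower_chartT_detP_eq_zero` (p703096, ns-wall-eng-3 g4) proves internally that, in a finite scale-free tower
`Σ_{l∈K} U_{H_l}` annihilated by the order-one horizon law off the centre, the HOMOGENISED CLASS POLYNOMIAL
`Q_N = Σ_{j,k ∈ K, j+k ≤ N, j+k ≡ N (2)} (λ_j − λ_k) ρ^{(N−j−k)/2} · detP P_j P_k`  (`λ_j = j(j+1)`, `ρ = x₀² + x₁² + x₂²`, `P_l` the
polynomial models of the shells) VANISHES as a polynomial whenever every pair above `N` has zero bracket — and then only exports its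
null-cone trace.  Here we export the polynomial identity itself (`finiteTower_classPoly_eq_zero`, same proof), and specialise it to the
tower `K = {2, 4, 6}` (`N = 10`, no pair above):  ★ `7ρ² {P₂, P₄} + 18ρ {P₂, P₆} + 11 {P₄, P₆} = 0`
(`finiteTower_classIdentity_twoFourSix`) — the identity whose three `ρ`-adic digits decide the tower.

HONEST LABEL: algebra about one crux idea's typed objects; no sketch Prop closed; `HorizonTowerZonality` (general towers),
`PoloidalLiouville` (1222) OPEN; NS regularity NOT proved.  [folklore]
-/

-- the summit and its single sub-problem share the name (CONVENTIONS §1)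
set_option linter.dupNamespace false

noncomputable section

open MvPolynomial
open scoped RealInnerProductSpace
open Literature.Analysis.FluidPDE (cross)
open Literature.Geometry.DiscreteGeometry (inner_fin3 norm_sq_fin3)

namespace Summit.NavierStokesRegularity.NavierStokesRegularity.Theorems.PoloidalLiouville.HorizonTower

section FiniteTower

variable (K : Finset ℕ) (H : ℕ → E3 → ℝ)

/-- ★ **THE CLASS POLYNOMIAL IDENTITY.**  In a finite tower passing order one, if every pair of degrees `{j, k}` with `j + k > N` has
`detP P_j P_k = 0`, then the homogenised class polynomial of level `N` vanishes identically:
`Σ_{j,k ∈ K, j+k ≤ N, j+k ≡ N (2)} (j(j+1) − k(k+1)) ρ^{(N−j−k)/2} detP P_j P_k = 0`.  (Proof = steps (1)–(2) of the isolation lemma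
`finiteTower_chartT_detP_eq_zero`, p703096.) [folklore] -/
theorem finiteTower_classPoly_eq_zero (hK : ∀ l ∈ K, 1 ≤ l) (hH : ∀ l ∈ K, ContDiff ℝ (⊤ : ℕ∞) (H l))
    (hhom : ∀ l ∈ K, ∀ (c : ℝ) (y : E3), H l (c • y) = c ^ l * H l y)
    (hharm : ∀ l ∈ K, ∀ y, Laplacian.laplacian (H l) y = 0)
    (hL1 : ∀ x : E3, x ≠ 0 → horizonL1 (fun z => ∑ l ∈ K, horizonProfile l (H l) 0 z) 0 x = 0)
    (P : ℕ → MvPolynomial (Fin 3) ℝ) (hP : ∀ l ∈ K, ∀ y, H l y = Zonal.evalE (P l) y) (N : ℕ)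
    (habove : ∀ j ∈ K, ∀ k ∈ K, N < j + k → Zonal.detP (P j) (P k) = 0) :
    (∑ j ∈ K, ∑ k ∈ K, if j + k ≤ N ∧ (j + k) % 2 = N % 2 then
      C ((j : ℝ) * (j + 1) - (k : ℝ) * (k + 1)) * ((X 0 ^ 2 + X 1 ^ 2 + X 2 ^ 2) ^ ((N - (j + k)) / 2) * Zonal.detP (P j) (P k))
      else 0) = 0 := by
  classical
  set ρ : MvPolynomial (Fin 3) ℝ := X 0 ^ 2 + X 1 ^ 2 + X 2 ^ 2 with hρ
  -- the bracket functions are the bracket polynomials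
  have hB : ∀ j ∈ K, ∀ k ∈ K, ∀ x : E3,
      ⟪x, cross (gradient (H j) x) (gradient (H k) x)⟫ = Zonal.evalE (Zonal.detP (P j) (P k)) x := by
    intro j hj k hk x
    rw [show H j = Zonal.evalE (P j) from funext (hP j hj), show H k = Zonal.evalE (P k) from funext (hP k hk)]
    exact LoopLaw.loopBracket_evalE (P j) (P k) x
  set Q : MvPolynomial (Fin 3) ℝ := ∑ j ∈ K, ∑ k ∈ K,
    if j + k ≤ N ∧ (j + k) % 2 = N % 2 then C ((j : ℝ) * (j + 1) - (k : ℝ) * (k + 1)) * (ρ ^ ((N - (j + k)) / 2) * Zonal.detP (P j) (P k)) else 0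
    with hQ
  -- (1) it vanishes off the centre
  have hQx : ∀ x : E3, x ≠ 0 → Zonal.evalE Q x = 0 := by
    intro x hx
    obtain ⟨hE, hO⟩ := finiteTower_parity_split K H hK hH hhom hharm hL1 hx
    have hS : ∑ j ∈ K, ∑ k ∈ K, (if (j + k) % 2 = N % 2 then
        (((j : ℝ) * (j + 1) - (k : ℝ) * (k + 1)) * (‖x‖ ^ 2) ^ (-(j : ℝ) / 2) * (‖x‖ ^ 2) ^ (-(k : ℝ) / 2)
          * ⟪x, cross (gradient (H j) x) (gradient (H k) x)⟫) else 0) = 0 := by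
      rcases Nat.even_or_odd N with hNe | hNo
      · have hN0 : N % 2 = 0 := Nat.even_iff.mp hNe
        refine Eq.trans (Finset.sum_congr rfl fun j _ => Finset.sum_congr rfl fun k _ => ?_) hE
        rw [hN0]
        by_cases hjk2 : Even (j + k)
        · rw [if_pos (Nat.even_iff.mp hjk2), if_pos hjk2]
        · rw [if_neg (by rw [Nat.even_iff] at hjk2; exact hjk2), if_neg hjk2]
      · have hN1 : N % 2 = 1 := Nat.odd_iff.mp hNo
        refine Eq.trans (Finset.sum_congr rfl fun j _ => Finset.sum_congr rfl fun k _ => ?_) hO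
        rw [hN1]
        by_cases hjk2 : Even (j + k)
        · rw [if_neg (by rw [Nat.even_iff.mp hjk2]; decide), if_pos hjk2]
        · rw [if_pos (Nat.odd_iff.mp (Nat.not_even_iff_odd.mp hjk2)), if_neg hjk2]
    have hterm : ∀ j ∈ K, ∀ k ∈ K,
        Zonal.evalE (if j + k ≤ N ∧ (j + k) % 2 = N % 2 then
            C ((j : ℝ) * (j + 1) - (k : ℝ) * (k + 1)) * (ρ ^ ((N - (j + k)) / 2) * Zonal.detP (P j) (P k)) else 0) x
          = (‖x‖ ^ 2) ^ ((N : ℝ) / 2) * (if (j + k) % 2 = N % 2 then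
            (((j : ℝ) * (j + 1) - (k : ℝ) * (k + 1)) * (‖x‖ ^ 2) ^ (-(j : ℝ) / 2) * (‖x‖ ^ 2) ^ (-(k : ℝ) / 2)
              * ⟪x, cross (gradient (H j) x) (gradient (H k) x)⟫) else 0) := by
      intro j hj k hk
      by_cases hpar : (j + k) % 2 = N % 2
      · by_cases hle : j + k ≤ N
        · obtain ⟨m, hm⟩ : ∃ m, N = j + k + 2 * m := ⟨(N - (j + k)) / 2, by omega⟩
          have hm' : (N - (j + k)) / 2 = m := by omega
          rw [if_pos ⟨hle, hpar⟩, if_pos hpar, hm', hB j hj k hk x]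
          have hw := rpow_weight_eq_pow hx hm
          have hρx : (eval fun i => x i) ρ = ‖x‖ ^ 2 := by rw [hρ, norm_sq_fin3]; simp
          simp only [Zonal.evalE, map_mul, eval_C, map_pow]
          rw [hρx, ← hw]
          ring
        · rw [if_neg (fun h => hle h.1), if_pos hpar, hB j hj k hk x, habove j hj k hk (not_le.mp hle)]
          simp [Zonal.evalE]
      · rw [if_neg (fun h => hpar h.2), if_neg hpar]
        simp [Zonal.evalE]
    have hQe : Zonal.evalE Q x = (‖x‖ ^ 2) ^ ((N : ℝ) / 2) * ∑ j ∈ K, ∑ k ∈ K, (if (j + k) % 2 = N % 2 then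
        (((j : ℝ) * (j + 1) - (k : ℝ) * (k + 1)) * (‖x‖ ^ 2) ^ (-(j : ℝ) / 2) * (‖x‖ ^ 2) ^ (-(k : ℝ) / 2)
          * ⟪x, cross (gradient (H j) x) (gradient (H k) x)⟫) else 0) := by
      rw [hQ, Finset.mul_sum]
      simp only [Zonal.evalE, map_sum]
      refine Finset.sum_congr rfl fun j hj => ?_
      rw [Finset.mul_sum]
      refine Finset.sum_congr rfl fun k hk => ?_
      have := hterm j hj k hk
      simp only [Zonal.evalE] at this
      exact this
    rw [hQe, hS, mul_zero]
  -- (2) hence `Q = 0` (a polynomial function vanishing off the origin vanishes)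
  apply Zonal.eq_zero_of_evalE_eq_zero
  have hcont : Continuous (Zonal.evalE Q) := (Zonal.contDiff_evalE Q).continuous
  have hEq : Zonal.evalE Q = fun _ => (0 : ℝ) :=
    Continuous.ext_on (dense_compl_singleton (0 : E3)) hcont continuous_const fun x hx => hQx x hx
  intro y
  rw [hEq]

end FiniteTower

/-! ### The tower `{2, 4, 6}` -/

/-- ★ **THE CLASS IDENTITY OF THE TOWER `{2, 4, 6}`**: for polynomial models `P₂, P₄, P₆` of the shells of a scale-free tower
`U_{H₂} + U_{H₄} + U_{H₆}` annihilated by the order-one horizon law off the centre,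
`7ρ² {P₂, P₄} + 18ρ {P₂, P₆} + 11 {P₄, P₆} = 0` (`{·,·} = Zonal.detP`, `ρ = Zonal.normSq`). [folklore] -/
theorem finiteTower_classIdentity_twoFourSix (H : ℕ → E3 → ℝ)
    (hH : ∀ l ∈ ({2, 4, 6} : Finset ℕ), ContDiff ℝ (⊤ : ℕ∞) (H l))
    (hhom : ∀ l ∈ ({2, 4, 6} : Finset ℕ), ∀ (c : ℝ) (y : E3), H l (c • y) = c ^ l * H l y)
    (hharm : ∀ l ∈ ({2, 4, 6} : Finset ℕ), ∀ y, Laplacian.laplacian (H l) y = 0)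
    (hL1 : ∀ x : E3, x ≠ 0 → horizonL1 (fun z => ∑ l ∈ ({2, 4, 6} : Finset ℕ), horizonProfile l (H l) 0 z) 0 x = 0)
    (P : ℕ → MvPolynomial (Fin 3) ℝ) (hP : ∀ l ∈ ({2, 4, 6} : Finset ℕ), ∀ y, H l y = Zonal.evalE (P l) y) :
    C 7 * Zonal.normSq ^ 2 * Zonal.detP (P 2) (P 4) + C 18 * Zonal.normSq * Zonal.detP (P 2) (P 6)
      + C 11 * Zonal.detP (P 4) (P 6) = 0 := by
  classical
  have hK : ∀ l ∈ ({2, 4, 6} : Finset ℕ), 1 ≤ l := by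
    intro l hl
    simp only [Finset.mem_insert, Finset.mem_singleton] at hl
    omega
  have h := finiteTower_classPoly_eq_zero {2, 4, 6} H hK hH hhom hharm hL1 P hP 10 (by
    intro j hj k hk hjk
    simp only [Finset.mem_insert, Finset.mem_singleton] at hj hk
    rcases hj with rfl | rfl | rfl <;> rcases hk with rfl | rfl | rfl <;> first | omega | exact Zonal.detP_self' _)
  have h24 : (2 : ℕ) ∉ ({4, 6} : Finset ℕ) := by decide
  have h46 : (4 : ℕ) ∉ ({6} : Finset ℕ) := by decide
  simp only [Finset.sum_insert h24, Finset.sum_insert h46, Finset.sum_singleton] at h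
  norm_num at h
  rw [Zonal.detP_antisymm (P 2) (P 4), Zonal.detP_antisymm (P 2) (P 6), Zonal.detP_antisymm (P 4) (P 6)] at h
  have h4 : (C (-4 : ℝ) : MvPolynomial (Fin 3) ℝ) ≠ 0 := by rw [Ne, C_eq_zero]; norm_num
  have key : C (-4 : ℝ) * (C 7 * Zonal.normSq ^ 2 * Zonal.detP (P 2) (P 4) + C 18 * Zonal.normSq * Zonal.detP (P 2) (P 6)
      + C 11 * Zonal.detP (P 4) (P 6)) = 0 := by
    rw [← h, Zonal.normSq]
    simp only [map_neg, map_ofNat]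
    ring
  exact (mul_eq_zero.mp key).resolve_left h4

end Summit.NavierStokesRegularity.NavierStokesRegularity.Theorems.PoloidalLiouville.HorizonTower

end
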